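import Summits.BirchSwinnertonDyer.Rank1Residual.Additive.RamifiedOrdinaryLineHalfPower
import Summits.BirchSwinnertonDyer.Rank1Residual.Additive.RamifiedOrdinaryLineNoMatchingMixedParity
import HarnessLib

/-!
# DEAD MIXED-PARITY LINKS: a line-even (G-ord) curve (`e ∈ {4,6}`, `(p−1)/e` odd) and a quotient-even
# (G-ord) curve (`(p−1)/e₁` even) have NO line-matching `E[p] ≃ E₁[p]` — S4b instantiated; and the
# PARITY DICHOTOMY ('at least one of line-even / quotient-even') for every (G-ord) row with `e ≠ 2`
# (cell `b2b-bsdres`, team n1011, seat p16 (gen 7); row T-ROL-ORD (p07) consumer §E, idle rule;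
# the first kernel CUSTOMER of the (P-e46-odd) producer `RamifiedOrdinaryLineHalfPower` on the
# GENUINE swap locus of cc-typer-2's parity dictionary)

HONEST FRAMING (cell `b2b-bsdres`, run/shared/lean/b2b/bsd-rank1-residual/, verbatim in every
file): the goal of the cell is to DELETE the COMBINATION-SHAPED residual classes of the
Birch–Swinnerton-Dyer formula for ALL analytic-rank `≤ 1` elliptic curves over `ℚ` — "full BSD
formula for every rank `≤ 1` curve in class `C`" assembled STRICTLY from published theorems — so
that the rank-`≤ 1` remainder becomes exactly the CONSTRUCTION-SHAPED classes, which are TYPED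
(missing-input `Prop`s), NOT attempted. This is not "finishing BSD". Team n1011 (N10/N11): research
route on the CONSTRUCTION-SHAPED classes X3♯(G-ord)/X4♯(G-ord); prove what is provable now; no
claim beyond stated classes; census output = EVIDENCE, never a Literature fact; RESIDUAL-MAP marks
UNCHANGED; nothing is booked by this file. TOOL theorems only: NO definition, NO named fact;
hypotheses = `TypeGOrd`, `Addv`, `5 ≤ p`, parities of `(p−1)/e`, `(p−1)/e₁`, `p ∈ v`, the lines.

## What and why

cc-typer-2's parity dictionary (`class-closure/N10/TRANSPORT-TEMPLATE.md` v2.1, S4/S4b): at an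
additive potentially good ORDINARY `p ≥ 5` the inertia characters of the ramified ordinary line
`C ⊂ E[p^∞]` are `ψ₁` (line) and `ψ₂` (quotient) with `ψ₁ψ₂ = χ̄_p`; exactly one of "`σ^{(p−1)/2}`
trivial on `C[p]`" (LINE-even) / "`σ^{(p−1)/2}` trivial on `E[p^∞]/C`" (QUOTIENT-even) holds, and
two curves whose lines have DIFFERENT parities admit NO inertia-equivariant `E[p] ≃+ E₁[p]` matching
the lines (S4b `not_forall_mem_iff_of_lineHalfPow_of_quotHalfPow`: a MIXED-parity congruence cannot
respect the `p`-stabilisations — the link is DEAD for the line transport of Route G / R3″). The two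
per-curve inputs are now BOTH in the tree for (G-ord) rows:
* LINE-even: FILE Q4 `IsRamifiedOrdinaryLine.lineHalfPow_of_typeGOrd_of_even` — `e` even, `e ≠ 2`,
  `(p−1)/e` ODD (`e = 4` at `p ≡ 5 (8)`, `e = 6` at `p ≡ 7 (12)`);
* QUOTIENT-even: p07's T-ROL-EXP B `IsRamifiedOrdinaryLine.pow_semistabilityIndex_smul_sub_mem`
  (`σ^{e₁}` trivial on the quotient, every `e₁ ∈ {2,3,4,6}`) lifted to `(p−1)/2` by S4
  `quotPow_of_dvd` when `e₁ ∣ (p−1)/2`, i.e. `(p−1)/e₁` EVEN (§1 `quotHalfPow_of_typeGOrd_of_even_div`).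
So (§2) on the cells `(5; 4,2)`, `(7; 6,3)`, `(13; 4,3)`, `(13; 4,6)`, `(29; 4,2)`, … of the dictionary
— line-even target × quotient-even (G-ord) partner — NO matching exists:
**`IsRamifiedOrdinaryLine.not_forall_mem_iff_of_even_of_even_div`** (and the symmetric order), with
`ClassX4Gord`/`ClassX3Gord` pair forms; and (§1) **`lineHalfPow_or_quotHalfPow_of_typeGOrd_of_ne_two`** —
the 'AT LEAST ONE' half of the parity dictionary that S4 §1 left unclaimed. COVERAGE: Q4 (`e` even `≠ 2`, `(p−1)/e` odd ⇒ line-even) and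
§1 (`(p−1)/e` even ⇒ quotient-even — this includes EVERY `e = 3` row, since `3 ∣ p − 1` and `p` odd
give `6 ∣ p − 1`) assign a parity to every (G-ord) row with `e ∈ {3, 4, 6}` at `p ≥ 5` WITHOUT the
exact order of the quotient character (p07 T-ROL-ORD F3, needed only for the 'NOT quotient-even'
statements); the one (G-ord) cell outside is `e = 2` at `p ≡ 3 (4)` ((P-def2-odd), cc-typer-2's).

HONEST LIMIT: a DEAD link is a statement about the line transport (no `hlines`/`TorsionIso`-compatible
matching), not about either curve's BSD; (M) / good-ordinary partners are not treated (B0's (M)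
exponent carries the A40/A41 named facts; good partners have no RAMIFIED line); nothing booked; no
link count of the census is changed by this file (EVIDENCE tables are cc-eng's).

References: R. Greenberg, V. Vatsal, Invent. Math. 142 (2000) §2 p. 26, Remark (2.9)
[GreenbergVatsal2000]; M. Emerton, R. Pollack, T. Weston, Invent. Math. 163 (2006) pp. 2–3, §3.1
[EmertonPollackWeston2006]; J.-P. Serre, Invent. Math. 15 (1972) §5.6 [Serre1972];
class-closure/N10/TRANSPORT-TEMPLATE.md v2.1 (parity dictionary, READ-OFF RULE).
-/

set_option autoImplicit false

noncomputable section

open scoped Classical NNReal NumberField AddSubgroup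

open WeierstrassCurve

universe u

namespace Literature.NumberTheory.EllipticCurves.EmertonPollackWeston2006.IsRamifiedOrdinaryLine

open NumberField IsDedekindDomain Field IsDedekindDomain.HeightOneSpectrum WeierstrassCurve
  Literature.NumberTheory.GaloisRepresentations Literature.NumberTheory.EllipticCurves
  Literature.NumberTheory.EllipticCurves.GreenbergSelmer
  Literature.NumberTheory.EllipticCurves.Rank1Residual
  Summit.BirchSwinnertonDyer.Rank1Residual.Additive
  Summit.BirchSwinnertonDyer.Rank1Residual.Additive.GoodModelLine

variable {W W₁ : WeierstrassCurve ℚ} [W.IsElliptic] [W.IsGloballyMinimal] [W₁.IsElliptic]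
  [W₁.IsGloballyMinimal] {p : ℕ} [hp : Fact p.Prime] {v : HeightOneSpectrum (𝓞 ℚ)}

/-! ## §1 QUOTIENT-even (G-ord) rows: `(p−1)/e` even -/

/-- **Quotient-even from the exponent** (`p ≥ 5`, (G-ord), `(p−1)/e` EVEN, any ramified ordinary
line): `σ^{(p−1)/2}` acts trivially on `E[p^∞]/C` for every local inertia element `σ` — p07's T-ROL-EXP
exponent `e` (`pow_semistabilityIndex_smul_sub_mem`) lifted by S4 `quotPow_of_dvd` along
`e ∣ (p−1)/2`. The cells `e = 2` at `p ≡ 1 (4)`, `e = 3`, `e = 4` at `p ≡ 1 (8)`, `e = 6` at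
`p ≡ 1 (12)` of the parity dictionary. [cite: Serre1972, §5.6 (p. 312)]
[cite: GreenbergVatsal2000, §2 p. 26] -/
theorem quotHalfPow_of_typeGOrd_of_even_div (hp5 : 5 ≤ p) (hG : TypeGOrd W p) (hadd : Addv W p)
    (heven : 2 ∣ (p - 1) / semistabilityIndex W p) (hpv : ((p : ℕ) : 𝓞 ℚ) ∈ v.asIdeal)
    {L : LocalDatum ℚ (W.geomPrimaryTorsion p) v} (hL : IsRamifiedOrdinaryLine W p L) :
    ∀ σ ∈ absInertia (v.adicCompletion ℚ), ∀ m : W.geomPrimaryTorsion p,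
      (absGaloisRestrict ℚ (v.adicCompletion ℚ) σ) ^ ((p - 1) / 2) • m - m ∈ L.plus := by
  have hedvd : semistabilityIndex W p ∣ p - 1 :=
    ((typeG_iff_not_subM_and_semistabilityIndex_dvd W p hp5).mp hG.typeG).2
  have hdvd : semistabilityIndex W p ∣ (p - 1) / 2 := by
    obtain ⟨q, hq⟩ := hedvd
    obtain ⟨r, hr⟩ := heven
    have he0 : semistabilityIndex W p ≠ 0 := semistabilityIndex_ne_zero p W
    have hq' : (p - 1) / semistabilityIndex W p = q := by
      rw [hq]; exact Nat.mul_div_cancel_left q (Nat.pos_of_ne_zero he0)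
    rw [hq'] at hr
    refine ⟨r, ?_⟩
    rw [hq, hr, ← mul_assoc, mul_comm (semistabilityIndex W p) 2, mul_assoc,
      Nat.mul_div_cancel_left _ two_pos]
  exact quotPow_of_dvd hdvd (hL.pow_semistabilityIndex_smul_sub_mem hp5 hG hadd hpv)

/-- **Every `e = 3` row is quotient-even** (`p ≥ 5`): `3 ∣ p − 1` (type (G)) and `p` odd give
`6 ∣ p − 1`, so `(p−1)/3` is even and §1 applies — no parity side condition and no exact order needed.
[cite: Serre1972, §5.6 (p. 312)] [cite: GreenbergVatsal2000, §2 p. 26] -/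
theorem quotHalfPow_of_typeGOrd_of_semistabilityIndex_eq_three (hp5 : 5 ≤ p) (hG : TypeGOrd W p)
    (hadd : Addv W p) (he3 : semistabilityIndex W p = 3) (hpv : ((p : ℕ) : 𝓞 ℚ) ∈ v.asIdeal)
    {L : LocalDatum ℚ (W.geomPrimaryTorsion p) v} (hL : IsRamifiedOrdinaryLine W p L) :
    ∀ σ ∈ absInertia (v.adicCompletion ℚ), ∀ m : W.geomPrimaryTorsion p,
      (absGaloisRestrict ℚ (v.adicCompletion ℚ) σ) ^ ((p - 1) / 2) • m - m ∈ L.plus := by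
  refine hL.quotHalfPow_of_typeGOrd_of_even_div hp5 hG hadd ?_ hpv
  have hedvd : semistabilityIndex W p ∣ p - 1 :=
    ((typeG_iff_not_subM_and_semistabilityIndex_dvd W p hp5).mp hG.typeG).2
  rw [he3] at hedvd ⊢
  have hodd := Nat.odd_iff.mp (hp.out.odd_of_ne_two (by omega))
  obtain ⟨q, hq⟩ := hedvd
  have hq' : (p - 1) / 3 = q := by rw [hq]; exact Nat.mul_div_cancel_left q (by norm_num)
  rw [hq']
  omega

/-- **PARITY DICHOTOMY — 'AT LEAST ONE'** (`p ≥ 5`, (G-ord), `e ≠ 2`, any ramified ordinary line):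
the line is LINE-even (`σ^{(p−1)/2}` trivial on `C[p]`) OR QUOTIENT-even (`σ^{(p−1)/2}` trivial on
`E[p^∞]/C`). S4 §1 `false_of_lineHalfPow_of_quotHalfPow` is 'not both'; 'at least one' was NOT claimed
there ("needs `Hom(I_v, ±1) = {1, ω^{(p−1)/2}}`") — on (G-ord) rows it now follows WITHOUT character
theory by cases on the parity of `(p−1)/e`: even ⇒ quotient-even (§1); odd ⇒ `e ≠ 3` (every `e = 3`
row has `(p−1)/3` even), so `e ∈ {4, 6, 12}` is even and Q4 `lineHalfPow_of_typeGOrd_of_even` applies.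
(`e = 2` at `p ≡ 3 (4)` is cc-typer-2's (P-def2-odd), excluded by `he2`.)
[cite: GreenbergVatsal2000, §2 p. 26] [cite: Serre1972, §5.6 (p. 312)] -/
theorem lineHalfPow_or_quotHalfPow_of_typeGOrd_of_ne_two (hp5 : 5 ≤ p) (hG : TypeGOrd W p)
    (hadd : Addv W p) (he2 : semistabilityIndex W p ≠ 2) (hpv : ((p : ℕ) : 𝓞 ℚ) ∈ v.asIdeal)
    {L : LocalDatum ℚ (W.geomPrimaryTorsion p) v} (hL : IsRamifiedOrdinaryLine W p L) :
    (∀ σ ∈ absInertia (v.adicCompletion ℚ), ∀ m ∈ L.plus, p • m = 0 →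
        (absGaloisRestrict ℚ (v.adicCompletion ℚ) σ) ^ ((p - 1) / 2) • m = m) ∨
      (∀ σ ∈ absInertia (v.adicCompletion ℚ), ∀ m : W.geomPrimaryTorsion p,
        (absGaloisRestrict ℚ (v.adicCompletion ℚ) σ) ^ ((p - 1) / 2) • m - m ∈ L.plus) := by
  by_cases heven : 2 ∣ (p - 1) / semistabilityIndex W p
  · exact Or.inr (hL.quotHalfPow_of_typeGOrd_of_even_div hp5 hG hadd heven hpv)
  · refine Or.inl (hL.lineHalfPow_of_typeGOrd_of_even hp5 hG hadd ?_ he2 heven hpv)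
    -- `(p−1)/e` odd forces `e ≠ 3`, and `e ∣ 12`, `e ≠ 1, 2, 3` ⇒ `2 ∣ e`
    have he12 := semistabilityIndex_dvd_twelve W p
    have hj : 0 ≤ padicValRat p W.j := padicValRat_j_nonneg_of_typeGOrd W p hG
    have he1 := semistabilityIndex_ne_one_of_addv W p hp5 hadd hj
    have he3 : semistabilityIndex W p ≠ 3 := fun h3 ↦ by
      have hedvd : semistabilityIndex W p ∣ p - 1 :=
        ((typeG_iff_not_subM_and_semistabilityIndex_dvd W p hp5).mp hG.typeG).2
      rw [h3] at hedvd heven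
      have hodd := Nat.odd_iff.mp (hp.out.odd_of_ne_two (by omega))
      obtain ⟨q, hq⟩ := hedvd
      have hq' : (p - 1) / 3 = q := by rw [hq]; exact Nat.mul_div_cancel_left q (by norm_num)
      rw [hq'] at heven
      omega
    have hle : semistabilityIndex W p ≤ 12 := Nat.le_of_dvd (by norm_num) he12
    have h0 : semistabilityIndex W p ≠ 0 := semistabilityIndex_ne_zero p W
    interval_cases h : semistabilityIndex W p <;> omega

/-! ## §2 MIXED parity ⇒ NO matching: line-even target × quotient-even (G-ord) partner -/

/-- **DEAD MIXED LINK** (`p ≥ 5`): `E` (G-ord) with even defect `e ≠ 2` and `(p−1)/e` ODD (line-even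
by Q4), `E₁` (G-ord) with `(p−1)/e₁` EVEN (quotient-even by §1): for ANY ramified ordinary lines
`C`, `C₁` and EVERY additive isomorphism `E[p] ≃+ E₁[p]` commuting with the local inertia group, the
lines are NOT matched (`¬ ∀ P, P ∈ C ↔ e P ∈ C₁`). S4b `not_forall_mem_iff_of_lineHalfPow_of_quotHalfPow`
with both per-curve inputs discharged. Cells `(5; 4,2)`, `(7; 6,3)`, `(13; 4,3)`, `(13; 4,6)`, ….
[cite: GreenbergVatsal2000, §2 p. 26 and Remark (2.9)]
[cite: EmertonPollackWeston2006, pp. 2–3 and §3.1 (eq:ordes) (arXiv:math/0404484 p. 17)] -/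
theorem not_forall_mem_iff_of_even_of_even_div (hp5 : 5 ≤ p)
    (hG : TypeGOrd W p) (hadd : Addv W p) (h2e : 2 ∣ semistabilityIndex W p)
    (he2 : semistabilityIndex W p ≠ 2) (hodd : ¬ 2 ∣ (p - 1) / semistabilityIndex W p)
    (hG₁ : TypeGOrd W₁ p) (hadd₁ : Addv W₁ p) (heven₁ : 2 ∣ (p - 1) / semistabilityIndex W₁ p)
    (hpv : ((p : ℕ) : 𝓞 ℚ) ∈ v.asIdeal)
    {L : LocalDatum ℚ ↥(W.geomPrimaryTorsion p) v} {L₁ : LocalDatum ℚ ↥(W₁.geomPrimaryTorsion p) v}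
    (hL : IsRamifiedOrdinaryLine W p L) (hL₁ : IsRamifiedOrdinaryLine W₁ p L₁)
    (e : ↥(geomTorsion W (p : ℤ)) ≃+ ↥(geomTorsion W₁ (p : ℤ)))
    (he : ∀ σ ∈ absInertia (v.adicCompletion ℚ), ∀ P : ↥(geomTorsion W (p : ℤ)),
      e (absGaloisRestrict ℚ (v.adicCompletion ℚ) σ • P) =
        absGaloisRestrict ℚ (v.adicCompletion ℚ) σ • e P) :
    ¬ ∀ P : ↥(geomTorsion W (p : ℤ)),
      (AddSubgroup.inclusion (geomTorsion_le_geomPrimaryTorsion W p) P ∈ L.plus ↔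
        AddSubgroup.inclusion (geomTorsion_le_geomPrimaryTorsion W₁ p) (e P) ∈ L₁.plus) := by
  have hp2 : p ≠ 2 := by omega
  exact hL.not_forall_mem_iff_of_lineHalfPow_of_quotHalfPow hp2 hL₁ hpv
    (hL.lineHalfPow_of_typeGOrd_of_even hp5 hG hadd h2e he2 hodd hpv)
    (hL₁.quotHalfPow_of_typeGOrd_of_even_div hp5 hG₁ hadd₁ heven₁ hpv) e he

/-- **DEAD MIXED LINK, other order**: `E` (G-ord) quotient-even (`(p−1)/e` EVEN), `E₁` (G-ord) line-even
(even defect `e₁ ≠ 2`, `(p−1)/e₁` ODD). [cite: GreenbergVatsal2000, §2 p. 26 and Remark (2.9)] -/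
theorem not_forall_mem_iff_of_even_div_of_even (hp5 : 5 ≤ p)
    (hG : TypeGOrd W p) (hadd : Addv W p) (heven : 2 ∣ (p - 1) / semistabilityIndex W p)
    (hG₁ : TypeGOrd W₁ p) (hadd₁ : Addv W₁ p) (h2e₁ : 2 ∣ semistabilityIndex W₁ p)
    (he2₁ : semistabilityIndex W₁ p ≠ 2) (hodd₁ : ¬ 2 ∣ (p - 1) / semistabilityIndex W₁ p)
    (hpv : ((p : ℕ) : 𝓞 ℚ) ∈ v.asIdeal)
    {L : LocalDatum ℚ ↥(W.geomPrimaryTorsion p) v} {L₁ : LocalDatum ℚ ↥(W₁.geomPrimaryTorsion p) v}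
    (hL : IsRamifiedOrdinaryLine W p L) (hL₁ : IsRamifiedOrdinaryLine W₁ p L₁)
    (e : ↥(geomTorsion W (p : ℤ)) ≃+ ↥(geomTorsion W₁ (p : ℤ)))
    (he : ∀ σ ∈ absInertia (v.adicCompletion ℚ), ∀ P : ↥(geomTorsion W (p : ℤ)),
      e (absGaloisRestrict ℚ (v.adicCompletion ℚ) σ • P) =
        absGaloisRestrict ℚ (v.adicCompletion ℚ) σ • e P) :
    ¬ ∀ P : ↥(geomTorsion W (p : ℤ)),
      (AddSubgroup.inclusion (geomTorsion_le_geomPrimaryTorsion W p) P ∈ L.plus ↔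
        AddSubgroup.inclusion (geomTorsion_le_geomPrimaryTorsion W₁ p) (e P) ∈ L₁.plus) := by
  have hp2 : p ≠ 2 := by omega
  exact hL.not_forall_mem_iff_of_quotHalfPow_of_lineHalfPow hp2 hL₁ hpv
    (hL.quotHalfPow_of_typeGOrd_of_even_div hp5 hG hadd heven hpv)
    (hL₁.lineHalfPow_of_typeGOrd_of_even hp5 hG₁ hadd₁ h2e₁ he2₁ hodd₁ hpv) e he

end Literature.NumberTheory.EllipticCurves.EmertonPollackWeston2006.IsRamifiedOrdinaryLine

/-! ## §3 Class pair forms -/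

namespace Summit.BirchSwinnertonDyer.Rank1Residual.Additive

open NumberField IsDedekindDomain Field IsDedekindDomain.HeightOneSpectrum WeierstrassCurve
  Literature.NumberTheory.GaloisRepresentations Literature.NumberTheory.EllipticCurves
  Literature.NumberTheory.EllipticCurves.GreenbergSelmer
  Literature.NumberTheory.EllipticCurves.EmertonPollackWeston2006
  Literature.NumberTheory.EllipticCurves.Rank1Residual

variable {W W₁ : WeierstrassCurve ℚ} [W.IsElliptic] [W.IsGloballyMinimal] [W₁.IsElliptic]
  [W₁.IsGloballyMinimal] {p : ℕ} [hp : Fact p.Prime] {v : HeightOneSpectrum (𝓞 ℚ)}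

/-- **X4♯(G-ord) × X4♯(G-ord), MIXED parity ⇒ DEAD link** (line-even target `(p−1)/e` odd, `e` even
`≠ 2`; quotient-even partner `(p−1)/e₁` even): no inertia-equivariant `E[p] ≃+ E₁[p]` matches the
ramified ordinary lines. X4♯(G-ord) stays CONSTRUCTION-SHAPED; nothing booked.
[cite: GreenbergVatsal2000, §2 p. 26 and Remark (2.9)] -/
theorem ClassX4Gord.not_forall_mem_iff_of_even_of_even_div (hX : ClassX4Gord W p)
    (hX₁ : ClassX4Gord W₁ p) (hp5 : 5 ≤ p)
    (h2e : 2 ∣ semistabilityIndex W p) (he2 : semistabilityIndex W p ≠ 2)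
    (hodd : ¬ 2 ∣ (p - 1) / semistabilityIndex W p) (heven₁ : 2 ∣ (p - 1) / semistabilityIndex W₁ p)
    (hpv : ((p : ℕ) : 𝓞 ℚ) ∈ v.asIdeal)
    {L : LocalDatum ℚ ↥(W.geomPrimaryTorsion p) v} {L₁ : LocalDatum ℚ ↥(W₁.geomPrimaryTorsion p) v}
    (hL : IsRamifiedOrdinaryLine W p L) (hL₁ : IsRamifiedOrdinaryLine W₁ p L₁)
    (e : ↥(geomTorsion W (p : ℤ)) ≃+ ↥(geomTorsion W₁ (p : ℤ)))
    (he : ∀ σ ∈ absInertia (v.adicCompletion ℚ), ∀ P : ↥(geomTorsion W (p : ℤ)),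
      e (absGaloisRestrict ℚ (v.adicCompletion ℚ) σ • P) =
        absGaloisRestrict ℚ (v.adicCompletion ℚ) σ • e P) :
    ¬ ∀ P : ↥(geomTorsion W (p : ℤ)),
      (AddSubgroup.inclusion (geomTorsion_le_geomPrimaryTorsion W p) P ∈ L.plus ↔
        AddSubgroup.inclusion (geomTorsion_le_geomPrimaryTorsion W₁ p) (e P) ∈ L₁.plus) :=
  hL.not_forall_mem_iff_of_even_of_even_div hp5 hX.typeGOrd hX.addv.2 h2e he2 hodd hX₁.typeGOrd
    hX₁.addv.2 heven₁ hpv hL₁ e he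

/-- **X3♯(G-ord) × X3♯(G-ord), MIXED parity ⇒ DEAD link.** X3♯(G-ord) stays CONSTRUCTION-SHAPED; nothing
booked. [cite: GreenbergVatsal2000, §2 p. 26 and Remark (2.9)] -/
theorem ClassX3Gord.not_forall_mem_iff_of_even_of_even_div (hX : ClassX3Gord W p)
    (hX₁ : ClassX3Gord W₁ p) (hp5 : 5 ≤ p)
    (h2e : 2 ∣ semistabilityIndex W p) (he2 : semistabilityIndex W p ≠ 2)
    (hodd : ¬ 2 ∣ (p - 1) / semistabilityIndex W p) (heven₁ : 2 ∣ (p - 1) / semistabilityIndex W₁ p)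
    (hpv : ((p : ℕ) : 𝓞 ℚ) ∈ v.asIdeal)
    {L : LocalDatum ℚ ↥(W.geomPrimaryTorsion p) v} {L₁ : LocalDatum ℚ ↥(W₁.geomPrimaryTorsion p) v}
    (hL : IsRamifiedOrdinaryLine W p L) (hL₁ : IsRamifiedOrdinaryLine W₁ p L₁)
    (e : ↥(geomTorsion W (p : ℤ)) ≃+ ↥(geomTorsion W₁ (p : ℤ)))
    (he : ∀ σ ∈ absInertia (v.adicCompletion ℚ), ∀ P : ↥(geomTorsion W (p : ℤ)),
      e (absGaloisRestrict ℚ (v.adicCompletion ℚ) σ • P) =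
        absGaloisRestrict ℚ (v.adicCompletion ℚ) σ • e P) :
    ¬ ∀ P : ↥(geomTorsion W (p : ℤ)),
      (AddSubgroup.inclusion (geomTorsion_le_geomPrimaryTorsion W p) P ∈ L.plus ↔
        AddSubgroup.inclusion (geomTorsion_le_geomPrimaryTorsion W₁ p) (e P) ∈ L₁.plus) :=
  hL.not_forall_mem_iff_of_even_of_even_div hp5 hX.typeGOrd hX.addv h2e he2 hodd hX₁.typeGOrd
    hX₁.addv heven₁ hpv hL₁ e he

/-- **X4♯(G-ord) target × X3♯(G-ord) partner, MIXED parity ⇒ DEAD link** (the cross-class links of the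
N10 tables). Nothing booked. [cite: GreenbergVatsal2000, §2 p. 26 and Remark (2.9)] -/
theorem ClassX4Gord.not_forall_mem_iff_of_even_of_even_div_classX3Gord (hX : ClassX4Gord W p)
    (hX₁ : ClassX3Gord W₁ p) (hp5 : 5 ≤ p)
    (h2e : 2 ∣ semistabilityIndex W p) (he2 : semistabilityIndex W p ≠ 2)
    (hodd : ¬ 2 ∣ (p - 1) / semistabilityIndex W p) (heven₁ : 2 ∣ (p - 1) / semistabilityIndex W₁ p)
    (hpv : ((p : ℕ) : 𝓞 ℚ) ∈ v.asIdeal)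
    {L : LocalDatum ℚ ↥(W.geomPrimaryTorsion p) v} {L₁ : LocalDatum ℚ ↥(W₁.geomPrimaryTorsion p) v}
    (hL : IsRamifiedOrdinaryLine W p L) (hL₁ : IsRamifiedOrdinaryLine W₁ p L₁)
    (e : ↥(geomTorsion W (p : ℤ)) ≃+ ↥(geomTorsion W₁ (p : ℤ)))
    (he : ∀ σ ∈ absInertia (v.adicCompletion ℚ), ∀ P : ↥(geomTorsion W (p : ℤ)),
      e (absGaloisRestrict ℚ (v.adicCompletion ℚ) σ • P) =
        absGaloisRestrict ℚ (v.adicCompletion ℚ) σ • e P) :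
    ¬ ∀ P : ↥(geomTorsion W (p : ℤ)),
      (AddSubgroup.inclusion (geomTorsion_le_geomPrimaryTorsion W p) P ∈ L.plus ↔
        AddSubgroup.inclusion (geomTorsion_le_geomPrimaryTorsion W₁ p) (e P) ∈ L₁.plus) :=
  hL.not_forall_mem_iff_of_even_of_even_div hp5 hX.typeGOrd hX.addv.2 h2e he2 hodd hX₁.typeGOrd
    hX₁.addv heven₁ hpv hL₁ e he

end Summit.BirchSwinnertonDyer.Rank1Residual.Additive


/-! ## §4 (M) partner at `p ≡ 1 (4)`: quotient-even (mod A40/A41), hence DEAD against a line-even target -/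

namespace Summit.BirchSwinnertonDyer.Rank1Residual.AdditivePotMult

open NumberField IsDedekindDomain Field IsDedekindDomain.HeightOneSpectrum WeierstrassCurve
  Literature.NumberTheory.GaloisRepresentations Literature.NumberTheory.EllipticCurves
  Literature.NumberTheory.EllipticCurves.GreenbergSelmer
  Literature.NumberTheory.EllipticCurves.EmertonPollackWeston2006
  Literature.NumberTheory.EllipticCurves.Rank1Residual
  Summit.BirchSwinnertonDyer.Rank1Residual.Additive

variable {W W₁ : WeierstrassCurve ℚ} [W.IsElliptic] [W.IsGloballyMinimal] [W₁.IsElliptic]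
  {p : ℕ} [hp : Fact p.Prime] {v : HeightOneSpectrum (𝓞 ℚ)}

/-- **pot-mult(p) at `p ≡ 1 (4)` is QUOTIENT-even** (mod A40/A41): the quotient exponent is `2`
(p07 B0 `PotMult.sq_smul_sub_mem_of_isRamifiedOrdinaryLine`, Tate uniformisation facts `hT40`/`hT41`)
and `2 ∣ (p−1)/2`; S4 `quotPow_of_dvd`. The (M) entry of the parity dictionary's (Q) column.
[cite: GreenbergVatsal2000, §2 pp. 14–15 and p. 26] [cite: SilvermanATAEC1994, Ch. V Thm. 5.3, Cor. 5.4] -/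
theorem PotMult.quotHalfPow_of_mod_four_eq_one
    (hT40 : Silverman1994_thmV53_tateUniformisation.{0})
    (hT41 : Silverman1994_thmV53_corV54_tateUniformisation.{0}) (hpm : PotMult W₁ p)
    (hp1 : p % 4 = 1) (hpv : ((p : ℕ) : 𝓞 ℚ) ∈ v.asIdeal)
    {L₁ : LocalDatum ℚ (W₁.geomPrimaryTorsion p) v} (hL₁ : IsRamifiedOrdinaryLine W₁ p L₁) :
    ∀ σ ∈ absInertia (v.adicCompletion ℚ), ∀ m : W₁.geomPrimaryTorsion p,
      (absGaloisRestrict ℚ (v.adicCompletion ℚ) σ) ^ ((p - 1) / 2) • m - m ∈ L₁.plus := by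
  have hp2 : p ≠ 2 := by omega
  have hdvd : 2 ∣ (p - 1) / 2 := ⟨(p - 1) / 4, by omega⟩
  exact IsRamifiedOrdinaryLine.quotPow_of_dvd hdvd
    (hpm.sq_smul_sub_mem_of_isRamifiedOrdinaryLine hT40 hT41 hp2 hpv hL₁)

/-- **DEAD MIXED LINK, (M) partner** (`p ≥ 5`, `p ≡ 1 (4)`; mod A40/A41): `E` (G-ord) line-even (even
defect `e ≠ 2`, `(p−1)/e` odd — at `p ≡ 1 (4)` this is `e = 4`, `p ≡ 5 (8)`), `E₁` potentially
multiplicative at `p`: NO inertia-equivariant `E[p] ≃+ E₁[p]` matches the ramified ordinary lines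
(cells `(5; 4,M)`, `(13; 4,M)`, `(29; 4,M)`, …). S4b with Q4 and the previous theorem.
[cite: GreenbergVatsal2000, §2 p. 26 and Remark (2.9)]
[cite: EmertonPollackWeston2006, pp. 2–3 and §3.1 (eq:ordes) (arXiv:math/0404484 p. 17)] -/
theorem PotMult.not_forall_mem_iff_of_even_of_potMult
    (hT40 : Silverman1994_thmV53_tateUniformisation.{0})
    (hT41 : Silverman1994_thmV53_corV54_tateUniformisation.{0}) (hp5 : 5 ≤ p)
    (hG : TypeGOrd W p) (hadd : Addv W p) (h2e : 2 ∣ semistabilityIndex W p)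
    (he2 : semistabilityIndex W p ≠ 2) (hodd : ¬ 2 ∣ (p - 1) / semistabilityIndex W p)
    (hpm₁ : PotMult W₁ p) (hp1 : p % 4 = 1) (hpv : ((p : ℕ) : 𝓞 ℚ) ∈ v.asIdeal)
    {L : LocalDatum ℚ ↥(W.geomPrimaryTorsion p) v} {L₁ : LocalDatum ℚ ↥(W₁.geomPrimaryTorsion p) v}
    (hL : IsRamifiedOrdinaryLine W p L) (hL₁ : IsRamifiedOrdinaryLine W₁ p L₁)
    (e : ↥(geomTorsion W (p : ℤ)) ≃+ ↥(geomTorsion W₁ (p : ℤ)))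
    (he : ∀ σ ∈ absInertia (v.adicCompletion ℚ), ∀ P : ↥(geomTorsion W (p : ℤ)),
      e (absGaloisRestrict ℚ (v.adicCompletion ℚ) σ • P) =
        absGaloisRestrict ℚ (v.adicCompletion ℚ) σ • e P) :
    ¬ ∀ P : ↥(geomTorsion W (p : ℤ)),
      (AddSubgroup.inclusion (geomTorsion_le_geomPrimaryTorsion W p) P ∈ L.plus ↔
        AddSubgroup.inclusion (geomTorsion_le_geomPrimaryTorsion W₁ p) (e P) ∈ L₁.plus) := by
  have hp2 : p ≠ 2 := by omega
  exact hL.not_forall_mem_iff_of_lineHalfPow_of_quotHalfPow hp2 hL₁ hpv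
    (hL.lineHalfPow_of_typeGOrd_of_even hp5 hG hadd h2e he2 hodd hpv)
    (hpm₁.quotHalfPow_of_mod_four_eq_one hT40 hT41 hp1 hpv hL₁) e he

end Summit.BirchSwinnertonDyer.Rank1Residual.AdditivePotMult

end
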